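import Summits.QuantumFields.BalabanUV.T4Continuum.Support.VariationalCovariantLipschitzRepair
import Summits.QuantumFields.BalabanUV.T4Continuum.Support.VariationalColourScalarPair

/-!
# T⁴ programme, spine node NE2 (U1a), lane P2 — SUPPLIER ITEM «V-COL-TWO-RUNS», file 1 of 2: THE TWO-RUNS FACE BY CONSTRAINT REPAIR FOR
# `E`-VALUED 0-FORMS WITH OPERATOR TRANSPORTS — two backgrounds `(R, T)`, `(R′, T′)` at the same level tied ONLY by the RAW distances
# `‖R′(y,μ) − R(y,μ)‖ ≤ ρ` (operator norm, bondwise, same gauge, no alignment) and `‖T′ x − T x‖ ≤ τ` (sitewise): `|Δ′(R′,T′)(μ) − Δ′(R,T)(μ)| ≤ e_L·Σ‖μ‖²`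
# (the colour twin of the road owner's `VariationalCovariantLipschitzRepair.scalar_repair_abs`; model level; cell `pub-balaban`)

NE2 formalisation swarm `b2b-balaban-t4-ne2-formalise-*`, leaf prover 02 (gen 6); register P2-sup, item «V-COL-TWO-RUNS» (INTENT CLAIMS.log l.17982).
The road owner's ABSTRACT repair lemma `VariationalCovariantLipschitzRepair.repair_half` (generic in the carrier: two constrained minimisations, leaf UB⁺ ∕ P⁺
for the first datum, leaf UB⁺ for the second, a constraint defect `qZ (Q′ f − Q f) ≤ τ²·qW f`, a form perturbation `Sc′ f ≤ (√Sc f + δ√qW f)²`, Minkowski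
for `√Sc′`) is used BY NAME; THIS FILE supplies its four colour inputs and reads it off in the colour letters of leaf-02-g4's `VariationalColourScalarPair`
(`Scv`, `qWv`, `Qkv`) and `VariationalColourFederbush` (`cDv`, `dirUv`):
 * §1 `Qkv_sub` (additivity of the transported average), **`nsqv_Qkv_sub_Qkv_le`** (constraint defect from the raw operator transport distance:
   `nsqv (Q_{T′} f − Q_T f) ≤ τ²·qWv f`, block Cauchy–Schwarz), `cDv_sub`, **`dirUv_perturb`** ∕ `sum_dirUv_perturb` ∕ **`Scv_perturb`** (one bond-operator
   perturbation `‖R₁(y,μ) − R₂(y,μ)‖ ≤ ρ` ⟹ `Scv_{R₁} f ≤ (√Scv_{R₂} f + √d·(n ρ)·√qWv f)²`; Minkowski in `y` and Cauchy–Schwarz in `μ` by the scalar road's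
   `sum_sq_add_le` ∕ `sum_fin_sq_add_le` BY NAME), **`Scv_sub_le`** (Minkowski `Scv (f − g) ≤ (√Scv f + √Scv g)²`);
 * §2 **`colour_repair_half`** ∕ **`colour_repair_abs`**: with leaf UB⁺ (`Λ`) + P⁺ (`C_P`) for BOTH data in LEAF SHAPE,
   `|blockSpin (Qkv T′) (Scv R′) μ − blockSpin (Qkv T) (Scv R) μ| ≤ (2·D·√Λ + D²)·nsqv μ`, `D = (√d·(n ρ) + √Λ·τ)·√(C_P(Λ+1))` — NO rephasing, NO alignment.
For two runs of Bałaban-type data in a COMMON gauge, `n·ρ` and `τ` are node NE3's currency (the two-run CLASS of file 2); nothing of NE3 is asserted here.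

HONEST FRAMING (T4-DAG p. 1).  MODEL LEVEL (bond operators `R, R′` and site operators `T, T′` on a finite-dimensional Hilbert space `E` are DATA; no
identification with Bałaban's `U(Γ)`, c5, no B0); [folklore] Minkowski ∕ Cauchy–Schwarz bookkeeping on top of the abstract repair lemma; nothing printed is a
hypothesis; no `def`, no `def … : Prop`, no `sorry`; axioms standard.  NE2 NOT proved on either road; NE3 OPEN; spine PROVED 0∕9; rung (B)+1 finite T⁴ — NOT
infinite volume, NOT mass gap, NOT Clay.  HONEST DEPENDENCY (cell, verbatim): continuum YM on T⁴ ⇐ BetaPertH ∧ nine spine estimates (0/9 proved); BetaPertH ⇐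
(D1) ∧ (D4) ∧ CAP+tail; G-an2-4 gates asym, D1 and NE2/3/4.
-/

noncomputable section

namespace Summit.QuantumFields.BalabanUV.T4Continuum.VariationalColourLipschitzRepair

open Finset
open Literature.MathematicalPhysics.QuantumFieldTheory.Balaban1983to89
open Literature.MathematicalPhysics.QuantumFieldTheory.Balaban1983to89.B5Prop11Plancherel (Tor fine unitVec)
open Literature.MathematicalPhysics.QuantumFieldTheory.Balaban1983to89.B5Block118 (bpt)
open Summit.QuantumFields.BalabanUV.T4Continuum.VariationalTransfer (blockSpin)
open Summit.QuantumFields.BalabanUV.T4Continuum.VariationalCovariantFederbush (sum_sq_add_le sum_fin_sq_add_le)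
open Summit.QuantumFields.BalabanUV.T4Continuum.VariationalColourFederbush (cDv dirUv dirUv_nonneg Qcv)
open Summit.QuantumFields.BalabanUV.T4Continuum.VariationalColourUpperBound (nsqv nsqv_nonneg)
open Summit.QuantumFields.BalabanUV.T4Continuum.VariationalColourScalarPair
  (Scv qWv Qkv Scv_nonneg qWv_nonneg norm_sq_le_qWv continuous_Qcv continuous_sum_dirUv)
open Summit.QuantumFields.BalabanUV.T4Continuum.VariationalCovariantLipschitzRepair (repair_half)

variable {d : ℕ} {E : Type*} [NormedAddCommGroup E] [InnerProductSpace ℂ E] [CompleteSpace E]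

/-! ## §1 The colour inputs of the repair lemma -/

section Level

variable (n : ℕ) [NeZero n] (M : Fin d → ℕ) [hM : ∀ μ, NeZero (M μ)]

omit [NeZero n] hM [CompleteSpace E] in
/-- the transported block average is additive in the field. [folklore] -/
theorem Qkv_sub (T : Tor (fine n M) → (E →L[ℂ] E)) (f g : Tor (fine n M) → E) : Qkv n M T (f - g) = Qkv n M T f - Qkv n M T g := by
  funext z
  simp only [Qkv, Qcv, Pi.sub_apply, map_sub, Finset.sum_sub_distrib, smul_sub]

omit [CompleteSpace E] in
/-- **CONSTRAINT DEFECT from the raw operator transport distance**: `Σ_z ‖Q_{T′} f (z) − Q_T f (z)‖² ≤ τ²·qWv f` when `‖T′ x − T x‖ ≤ τ` (block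
Cauchy–Schwarz). [folklore] -/
theorem nsqv_Qkv_sub_Qkv_le {T T' : Tor (fine n M) → (E →L[ℂ] E)} {τ : ℝ} (hτ : ∀ x, ‖T' x - T x‖ ≤ τ) (f : Tor (fine n M) → E) :
    nsqv (Qkv n M T' f - Qkv n M T f) ≤ τ ^ 2 * qWv n M f := by
  have hn0 : (0 : ℝ) < (n : ℝ) ^ d := by have := NeZero.ne n; positivity
  -- per block
  have hz : ∀ z : Tor M, ‖(Qkv n M T' f - Qkv n M T f) z‖ ^ 2 ≤ τ ^ 2 * (((n : ℝ) ^ d)⁻¹ * ∑ j : Fin d → Fin n, ‖f (bpt n M z j)‖ ^ 2) := by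
    intro z
    have hexpr : (Qkv n M T' f - Qkv n M T f) z
        = ((n : ℂ) ^ d)⁻¹ • ∑ j : Fin d → Fin n, (T' (bpt n M z j) - T (bpt n M z j)) (f (bpt n M z j)) := by
      simp only [Pi.sub_apply, Qkv, Qcv, ← smul_sub, ← Finset.sum_sub_distrib, FunLike.coe_sub, Pi.sub_apply]
    rw [hexpr, norm_smul, norm_inv, norm_pow, Complex.norm_natCast, mul_pow, inv_pow]
    have hsum : ‖∑ j : Fin d → Fin n, (T' (bpt n M z j) - T (bpt n M z j)) (f (bpt n M z j))‖
        ≤ τ * ∑ j : Fin d → Fin n, ‖f (bpt n M z j)‖ := by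
      rw [Finset.mul_sum]
      refine (norm_sum_le _ _).trans (Finset.sum_le_sum fun j _ => ?_)
      exact (ContinuousLinearMap.le_opNorm _ _).trans (mul_le_mul_of_nonneg_right (hτ _) (norm_nonneg _))
    have hcs : (∑ j : Fin d → Fin n, ‖f (bpt n M z j)‖) ^ 2 ≤ (n : ℝ) ^ d * ∑ j : Fin d → Fin n, ‖f (bpt n M z j)‖ ^ 2 := by
      have h := sq_sum_le_card_mul_sum_sq (s := (Finset.univ : Finset (Fin d → Fin n))) (f := fun j => ‖f (bpt n M z j)‖)
      simpa [Finset.card_univ, Fintype.card_fun, Fintype.card_fin] using h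
    have h1 : ‖∑ j : Fin d → Fin n, (T' (bpt n M z j) - T (bpt n M z j)) (f (bpt n M z j))‖ ^ 2
        ≤ τ ^ 2 * ((n : ℝ) ^ d * ∑ j : Fin d → Fin n, ‖f (bpt n M z j)‖ ^ 2) := by
      calc _ ≤ (τ * ∑ j : Fin d → Fin n, ‖f (bpt n M z j)‖) ^ 2 := pow_le_pow_left₀ (norm_nonneg _) hsum 2
        _ = τ ^ 2 * (∑ j : Fin d → Fin n, ‖f (bpt n M z j)‖) ^ 2 := by ring
        _ ≤ τ ^ 2 * ((n : ℝ) ^ d * ∑ j : Fin d → Fin n, ‖f (bpt n M z j)‖ ^ 2) := mul_le_mul_of_nonneg_left hcs (sq_nonneg τ)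
    calc (((n : ℝ) ^ d) ^ 2)⁻¹ * ‖∑ j : Fin d → Fin n, (T' (bpt n M z j) - T (bpt n M z j)) (f (bpt n M z j))‖ ^ 2
        ≤ (((n : ℝ) ^ d) ^ 2)⁻¹ * (τ ^ 2 * ((n : ℝ) ^ d * ∑ j : Fin d → Fin n, ‖f (bpt n M z j)‖ ^ 2)) :=
          mul_le_mul_of_nonneg_left h1 (by positivity)
      _ = τ ^ 2 * (((n : ℝ) ^ d)⁻¹ * ∑ j : Fin d → Fin n, ‖f (bpt n M z j)‖ ^ 2) := by field_simp
  -- sum over blocks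
  unfold nsqv qWv
  calc ∑ z, ‖(Qkv n M T' f - Qkv n M T f) z‖ ^ 2
      ≤ ∑ z, τ ^ 2 * (((n : ℝ) ^ d)⁻¹ * ∑ j : Fin d → Fin n, ‖f (bpt n M z j)‖ ^ 2) := Finset.sum_le_sum fun z _ => hz z
    _ = τ ^ 2 * (((n : ℝ) ^ d)⁻¹ * ∑ z, ∑ j : Fin d → Fin n, ‖f (bpt n M z j)‖ ^ 2) := by rw [← Finset.mul_sum, ← Finset.mul_sum]
    _ = τ ^ 2 * (((n : ℝ) ^ d)⁻¹ * ∑ x, ‖f x‖ ^ 2) := by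
        rw [B5AverageCurlStokes.sum_blocks_real n M (fun x => ‖f x‖ ^ 2)]
    _ = τ ^ 2 * (((n : ℝ) ^ d)⁻¹ * nsqv f) := rfl

end Level

section OneLevel

variable (N : Fin d → ℕ) [hN : ∀ μ, NeZero (N μ)]

omit hN [CompleteSpace E] in
/-- the covariant difference is additive in the field. [folklore] -/
theorem cDv_sub (R : Tor N → Fin d → (E →L[ℂ] E)) (f g : Tor N → E) (y : Tor N) (μ : Fin d) :
    cDv N R (f - g) y μ = cDv N R f y μ - cDv N R g y μ := by
  simp only [cDv, Pi.sub_apply, map_sub]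
  abel

omit [InnerProductSpace ℂ E] [CompleteSpace E] in
/-- squared norms are translation invariant on the torus: `Σ_y ‖f(y + e_μ)‖² = nsqv f`. [folklore] -/
theorem sum_norm_sq_translate (f : Tor N → E) (μ : Fin d) : ∑ y, ‖f (y + unitVec N μ)‖ ^ 2 = nsqv f := by
  unfold nsqv
  exact Equiv.sum_comp (Equiv.addRight (unitVec N μ)) (fun x => ‖f x‖ ^ 2)

omit [CompleteSpace E] in
/-- **ONE BOND-OPERATOR PERTURBATION OF THE DIRECTIONAL DIRICHLET SUM**: `‖R₁(y,μ) − R₂(y,μ)‖ ≤ ρ` ⟹ `dirUv R₁ f μ ≤ (√(dirUv R₂ f μ) + ρ·√(nsqv f))²`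
(Minkowski in `y`). [folklore] -/
theorem dirUv_perturb {R₁ R₂ : Tor N → Fin d → (E →L[ℂ] E)} {ρ : ℝ} (hρ0 : 0 ≤ ρ) (hρ : ∀ y μ, ‖R₁ y μ - R₂ y μ‖ ≤ ρ)
    (f : Tor N → E) (μ : Fin d) : dirUv N R₁ f μ ≤ (Real.sqrt (dirUv N R₂ f μ) + ρ * Real.sqrt (nsqv f)) ^ 2 := by
  have hpt : ∀ y, ‖cDv N R₁ f y μ‖ ≤ ‖cDv N R₂ f y μ‖ + ρ * ‖f (y + unitVec N μ)‖ := by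
    intro y
    have e : cDv N R₁ f y μ = cDv N R₂ f y μ + (R₁ y μ - R₂ y μ) (f (y + unitVec N μ)) := by
      simp only [cDv, FunLike.coe_sub, Pi.sub_apply]; abel
    rw [e]
    refine (norm_add_le _ _).trans (add_le_add le_rfl ?_)
    exact (ContinuousLinearMap.le_opNorm _ _).trans (mul_le_mul_of_nonneg_right (hρ y μ) (norm_nonneg _))
  have h1 : dirUv N R₁ f μ ≤ ∑ y, (‖cDv N R₂ f y μ‖ + ρ * ‖f (y + unitVec N μ)‖) ^ 2 := by
    unfold dirUv
    exact sum_le_sum fun y _ => pow_le_pow_left₀ (norm_nonneg _) (hpt y) 2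
  refine h1.trans ((sum_sq_add_le univ (fun y => ‖cDv N R₂ f y μ‖) (fun y => ‖f (y + unitVec N μ)‖) hρ0).trans (le_of_eq ?_))
  rw [sum_norm_sq_translate]
  rfl

omit [CompleteSpace E] in
/-- summed over directions (Cauchy–Schwarz in `μ`): `Σ_μ dirUv R₁ f μ ≤ (√(Σ_μ dirUv R₂ f μ) + √d·ρ·√(nsqv f))²`. [folklore] -/
theorem sum_dirUv_perturb {R₁ R₂ : Tor N → Fin d → (E →L[ℂ] E)} {ρ : ℝ} (hρ0 : 0 ≤ ρ) (hρ : ∀ y μ, ‖R₁ y μ - R₂ y μ‖ ≤ ρ)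
    (f : Tor N → E) : ∑ μ, dirUv N R₁ f μ ≤ (Real.sqrt (∑ μ, dirUv N R₂ f μ) + Real.sqrt d * (ρ * Real.sqrt (nsqv f))) ^ 2 := by
  have hb : 0 ≤ ρ * Real.sqrt (nsqv f) := mul_nonneg hρ0 (Real.sqrt_nonneg _)
  have h1 : ∑ μ, dirUv N R₁ f μ ≤ ∑ μ, (Real.sqrt (dirUv N R₂ f μ) + ρ * Real.sqrt (nsqv f)) ^ 2 :=
    sum_le_sum fun μ _ => dirUv_perturb N hρ0 hρ f μ
  refine h1.trans ((sum_fin_sq_add_le (fun μ => Real.sqrt (dirUv N R₂ f μ)) hb).trans (le_of_eq ?_))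
  congr 2
  exact congrArg Real.sqrt (sum_congr rfl fun μ _ => Real.sq_sqrt (dirUv_nonneg N R₂ f μ))

end OneLevel

section LevelN

variable (n : ℕ) [NeZero n] (M : Fin d → ℕ) [hM : ∀ μ, NeZero (M μ)]

omit [CompleteSpace E] in
/-- **ONE BOND-OPERATOR PERTURBATION OF THE COLOUR COVARIANT FORM, PHYSICAL UNITS**: `‖R₁ − R₂‖ ≤ ρ` bondwise ⟹
`Scv_{R₁}(f) ≤ (√Scv_{R₂}(f) + √d·(n·ρ)·√qWv(f))²`. [folklore] -/
theorem Scv_perturb {R₁ R₂ : Tor (fine n M) → Fin d → (E →L[ℂ] E)} {ρ : ℝ} (hρ0 : 0 ≤ ρ)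
    (hρ : ∀ y μ, ‖R₁ y μ - R₂ y μ‖ ≤ ρ) (f : Tor (fine n M) → E) :
    Scv n M R₁ f ≤ (Real.sqrt (Scv n M R₂ f) + Real.sqrt d * ((n : ℝ) * ρ) * Real.sqrt (qWv n M f)) ^ 2 := by
  have hn : (0 : ℝ) < (n : ℝ) := by exact_mod_cast Nat.pos_of_ne_zero (NeZero.ne n)
  have hnd : (0 : ℝ) < (n : ℝ) ^ d := by positivity
  set c : ℝ := (n : ℝ) ^ 2 / (n : ℝ) ^ d with hcdef
  have hc0 : 0 ≤ c := by positivity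
  set D₂ : ℝ := ∑ μ, dirUv (fine n M) R₂ f μ with hD₂
  set Y : ℝ := nsqv f with hY
  have h : ∑ μ, dirUv (fine n M) R₁ f μ ≤ (Real.sqrt D₂ + Real.sqrt d * (ρ * Real.sqrt Y)) ^ 2 := sum_dirUv_perturb (fine n M) hρ0 hρ f
  have hSc₁ : Scv n M R₁ f = c * ∑ μ, dirUv (fine n M) R₁ f μ := rfl
  have hSc₂ : Scv n M R₂ f = c * D₂ := rfl
  have hqW : qWv n M f = ((n : ℝ) ^ d)⁻¹ * Y := rfl
  have e1 : Real.sqrt c * Real.sqrt D₂ = Real.sqrt (Scv n M R₂ f) := by rw [← Real.sqrt_mul hc0, hSc₂]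
  have e2 : Real.sqrt c * (Real.sqrt d * (ρ * Real.sqrt Y)) = Real.sqrt d * ((n : ℝ) * ρ) * Real.sqrt (qWv n M f) := by
    have h1 : Real.sqrt c * Real.sqrt Y = n * Real.sqrt (qWv n M f) := by
      have e : c * Y = (n : ℝ) ^ 2 * qWv n M f := by rw [hqW, hcdef]; field_simp
      rw [← Real.sqrt_mul hc0, e, Real.sqrt_mul (sq_nonneg _), Real.sqrt_sq hn.le]
    calc Real.sqrt c * (Real.sqrt d * (ρ * Real.sqrt Y)) = Real.sqrt d * ρ * (Real.sqrt c * Real.sqrt Y) := by ring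
      _ = _ := by rw [h1]; ring
  have hsq : Real.sqrt c ^ 2 = c := Real.sq_sqrt hc0
  have key : ∀ a b : ℝ, c * (a + b) ^ 2 = (Real.sqrt c * a + Real.sqrt c * b) ^ 2 := by
    intro a b
    calc c * (a + b) ^ 2 = Real.sqrt c ^ 2 * (a + b) ^ 2 := by rw [hsq]
      _ = (Real.sqrt c * a + Real.sqrt c * b) ^ 2 := by ring
  calc Scv n M R₁ f = c * ∑ μ, dirUv (fine n M) R₁ f μ := hSc₁
    _ ≤ c * (Real.sqrt D₂ + Real.sqrt d * (ρ * Real.sqrt Y)) ^ 2 := mul_le_mul_of_nonneg_left h hc0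
    _ = (Real.sqrt c * Real.sqrt D₂ + Real.sqrt c * (Real.sqrt d * (ρ * Real.sqrt Y))) ^ 2 := key _ _
    _ = _ := by rw [e1, e2]

omit [CompleteSpace E] in
/-- **Minkowski for the colour covariant Dirichlet form**: `Scv (f − g) ≤ (√Scv f + √Scv g)²`. [folklore] -/
theorem Scv_sub_le (Rc : Tor (fine n M) → Fin d → (E →L[ℂ] E)) (f g : Tor (fine n M) → E) :
    Scv n M Rc (f - g) ≤ (Real.sqrt (Scv n M Rc f) + Real.sqrt (Scv n M Rc g)) ^ 2 := by
  have hn0 : (0 : ℝ) ≤ (n : ℝ) ^ 2 / (n : ℝ) ^ d := by positivity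
  -- lattice Minkowski over the index pairs (μ, y)
  have hlat : ∑ μ, dirUv (fine n M) Rc (f - g) μ
      ≤ (Real.sqrt (∑ μ, dirUv (fine n M) Rc f μ) + Real.sqrt (∑ μ, dirUv (fine n M) Rc g μ)) ^ 2 := by
    have hsplit : ∀ μ (y : Tor (fine n M)), ‖cDv (fine n M) Rc (f - g) y μ‖ ≤ ‖cDv (fine n M) Rc f y μ‖ + 1 * ‖cDv (fine n M) Rc g y μ‖ := by
      intro μ y
      rw [cDv_sub, one_mul]; exact norm_sub_le _ _
    unfold dirUv
    rw [← Finset.sum_product' (s := Finset.univ) (t := Finset.univ) (f := fun μ y => ‖cDv (fine n M) Rc (f - g) y μ‖ ^ 2),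
      ← Finset.sum_product' (s := Finset.univ) (t := Finset.univ) (f := fun μ y => ‖cDv (fine n M) Rc f y μ‖ ^ 2),
      ← Finset.sum_product' (s := Finset.univ) (t := Finset.univ) (f := fun μ y => ‖cDv (fine n M) Rc g y μ‖ ^ 2)]
    have h := sum_sq_add_le (Finset.univ ×ˢ Finset.univ) (fun p : Fin d × Tor (fine n M) => ‖cDv (fine n M) Rc f p.2 p.1‖)
      (fun p => ‖cDv (fine n M) Rc g p.2 p.1‖) (m := 1) zero_le_one
    simp only [one_mul] at h
    refine le_trans (Finset.sum_le_sum fun p _ => ?_) h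
    have := hsplit p.1 p.2
    rw [one_mul] at this
    exact pow_le_pow_left₀ (norm_nonneg _) this 2
  unfold Scv
  have e : ∀ X : ℝ, 0 ≤ X → Real.sqrt ((n : ℝ) ^ 2 / (n : ℝ) ^ d * X) = Real.sqrt ((n : ℝ) ^ 2 / (n : ℝ) ^ d) * Real.sqrt X := fun X _ =>
    Real.sqrt_mul hn0 X
  rw [e _ (Finset.sum_nonneg fun μ _ => dirUv_nonneg _ _ _ _), e _ (Finset.sum_nonneg fun μ _ => dirUv_nonneg _ _ _ _), ← mul_add,
    mul_pow, Real.sq_sqrt hn0]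
  exact mul_le_mul_of_nonneg_left hlat hn0

end LevelN

/-! ## §2 The two-runs face in colour -/

section Repair

omit [CompleteSpace E]
variable [FiniteDimensional ℂ E]
variable (n : ℕ) [NeZero n] (M : Fin d → ℕ) [hM : ∀ μ, NeZero (M μ)]

/-- **THE TWO-RUNS FACE BY CONSTRAINT REPAIR, COLOUR (one half)**: two backgrounds `(R, T)`, `(R′, T′)` at the same level, RAW distances
`‖R′ − R‖ ≤ ρ` (bondwise, operator norm) and `‖T′ − T‖ ≤ τ` (sitewise), leaf UB⁺ (`Λ`) + P⁺ (`C_P`) for `(R, T)`, leaf UB⁺ (`Λ′`) for `(R′, T′)` ⟹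
`Δ′(R′,T′)(μ) ≤ Δ′(R,T)(μ) + (2·D·√Λ + D²)·nsqv μ`, `D = (√d·(nρ) + √Λ′·τ)·√(C_P(Λ+1))`. [folklore] -/
theorem colour_repair_half {R R' : Tor (fine n M) → Fin d → (E →L[ℂ] E)} {T T' : Tor (fine n M) → (E →L[ℂ] E)}
    {ρ τ : ℝ} (hρ0 : 0 ≤ ρ) (hρ : ∀ y μ, ‖R' y μ - R y μ‖ ≤ ρ) (hτ0 : 0 ≤ τ) (hτ : ∀ x, ‖T' x - T x‖ ≤ τ)
    {Λ Λ' CP : ℝ} (hΛ : 0 ≤ Λ) (hΛ' : 0 ≤ Λ') (hCP : 0 ≤ CP)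
    (hUB : ∀ μ : Tor M → E, ∃ f, Qkv n M T f = μ ∧ Scv n M R f ≤ Λ * nsqv μ)
    (hP : ∀ f, qWv n M f ≤ CP * (Scv n M R f + nsqv (Qkv n M T f)))
    (hUB' : ∀ r : Tor M → E, ∃ g, Qkv n M T' g = r ∧ Scv n M R' g ≤ Λ' * nsqv r) (μ : Tor M → E) :
    blockSpin (Qkv n M T') (Scv n M R') μ ≤ blockSpin (Qkv n M T) (Scv n M R) μ
      + (2 * ((Real.sqrt d * ((n : ℝ) * ρ) + Real.sqrt Λ' * τ) * Real.sqrt (CP * (Λ + 1))) * Real.sqrt Λ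
          + ((Real.sqrt d * ((n : ℝ) * ρ) + Real.sqrt Λ' * τ) * Real.sqrt (CP * (Λ + 1))) ^ 2) * nsqv μ := by
  have hnd : (0 : ℝ) ≤ (n : ℝ) ^ d := by positivity
  refine repair_half (W := Tor (fine n M) → E) (Z := Tor M → E) (Q := Qkv n M T) (Q' := Qkv n M T') (Sc := Scv n M R) (Sc' := Scv n M R')
    (qW := qWv n M) (qZ := nsqv) (continuous_Qcv T) (continuous_sum_dirUv R _) (Qkv_sub n M T') (Scv_nonneg n M R) (Scv_nonneg n M R')
    (fun μ => nsqv_nonneg μ) hnd hΛ hΛ' hCP (by positivity) hτ0 (norm_sq_le_qWv n M) hUB hP hUB' ?_ ?_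
    (Scv_sub_le n M R') μ
  · intro f
    exact nsqv_Qkv_sub_Qkv_le n M hτ f
  · intro f
    exact Scv_perturb n M hρ0 hρ f

/-- **THE TWO-RUNS FACE BY CONSTRAINT REPAIR, COLOUR (symmetric)**: with UB⁺ + P⁺ for BOTH data (one common `Λ`, `C_P`),
`|Δ′(R′,T′)(μ) − Δ′(R,T)(μ)| ≤ e_L·nsqv μ`, `e_L = 2·D·√Λ + D²`, `D = (√d·(nρ) + √Λ·τ)·√(C_P(Λ+1))`. [folklore] -/
theorem colour_repair_abs {R R' : Tor (fine n M) → Fin d → (E →L[ℂ] E)} {T T' : Tor (fine n M) → (E →L[ℂ] E)}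
    {ρ τ : ℝ} (hρ0 : 0 ≤ ρ) (hρ : ∀ y μ, ‖R' y μ - R y μ‖ ≤ ρ) (hτ0 : 0 ≤ τ) (hτ : ∀ x, ‖T' x - T x‖ ≤ τ)
    {Λ CP : ℝ} (hΛ : 0 ≤ Λ) (hCP : 0 ≤ CP)
    (hUB : ∀ μ : Tor M → E, ∃ f, Qkv n M T f = μ ∧ Scv n M R f ≤ Λ * nsqv μ)
    (hP : ∀ f, qWv n M f ≤ CP * (Scv n M R f + nsqv (Qkv n M T f)))
    (hUB' : ∀ μ : Tor M → E, ∃ g, Qkv n M T' g = μ ∧ Scv n M R' g ≤ Λ * nsqv μ)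
    (hP' : ∀ f, qWv n M f ≤ CP * (Scv n M R' f + nsqv (Qkv n M T' f))) (μ : Tor M → E) :
    |blockSpin (Qkv n M T') (Scv n M R') μ - blockSpin (Qkv n M T) (Scv n M R) μ|
      ≤ (2 * ((Real.sqrt d * ((n : ℝ) * ρ) + Real.sqrt Λ * τ) * Real.sqrt (CP * (Λ + 1))) * Real.sqrt Λ
          + ((Real.sqrt d * ((n : ℝ) * ρ) + Real.sqrt Λ * τ) * Real.sqrt (CP * (Λ + 1))) ^ 2) * nsqv μ := by
  have hρ' : ∀ y μ, ‖R y μ - R' y μ‖ ≤ ρ := fun y μ => by rw [norm_sub_rev]; exact hρ y μ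
  have hτ' : ∀ x, ‖T x - T' x‖ ≤ τ := fun x => by rw [norm_sub_rev]; exact hτ x
  have h1 := colour_repair_half n M hρ0 hρ hτ0 hτ hΛ hΛ hCP hUB hP hUB' μ
  have h2 := colour_repair_half n M hρ0 hρ' hτ0 hτ' hΛ hΛ hCP hUB' hP' hUB μ
  rw [abs_le]; constructor <;> linarith

end Repair

end Summit.QuantumFields.BalabanUV.T4Continuum.VariationalColourLipschitzRepair

end
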